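import Summits.QuantumFields.BalabanUV.Beta.D1BFx.RoadEndBFxWiredS
import Literature.MathematicalPhysics.QuantumFieldTheory.Balaban1983to89.Beta.OneStepKernelFamily

/-!
# `BalabanUV.Beta.D1BFx.RoadEndBFxD1TelS` — road «BF-x» for binder row D1, slot (K): **THE JUNCTION WITH THE ROW's SPINE — BRIDGE B1 IS THE
# SPINE's `D1Tel` (EXACTLY), AND THE «END-ii» END OVER `D1Tel` + THE ONE-SHOT (K)-ESTIMATE ON THE LITERAL ONE-SHOT KERNEL `TshotOf Lc Jc`**

HONEST DEPENDENCY (cell records, verbatim): «continuum YM on T⁴ ⇐ BetaPertH ∧ nine spine estimates (0/9 proved); BetaPertH ⇐ (D1) ∧ (D4) ∧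
CAP+tail; G-an2-4 gates asym, D1 and NE2/3/4.»  HONEST FRAMING (cell contract, verbatim): «discharging `BetaPertH` makes Bałaban's UV stability
UNCONDITIONAL — a real constructive-QFT result; it is NOT the continuum limit and NOT the Clay problem.»  THIS MODULE DISCHARGES NOTHING of the
wall: [folklore] composition BY NAME of the lead's∕an2's scale-wise seam (`HidentScalewise.flowSum_eq_oneShotReadout`,
`ScalewiseVectorSeam.scalewiseData_of_printed_flip`, `…readout122_m2Tensor`, `OneStepKernelFamily.hdec_TbalOf`) with this road's «END-ii» END v1.1
`RoadEndBFxWiredS.d1Drift_BFx_of_prop12S'` (p297093).  No `def`, no `def … : Prop`, nothing cited, 0 sorry.  Root-level binders of row D1 (referee's census: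
hW ∕ hR-sockets ∕ hSX-socket ∕ D1Tel ∕ D1Rep) — 0 discharged; (K) NOT closed; NOT D1, NOT `BetaPertH`, NOT continuum, NOT Clay.

ABSOLUTE RULE (cell charter, verbatim): «No internally-minted statement may enter as a cited fact. Every hypothesis is either kernel-proved in
this package or a verbatim quotation of a PUBLISHED theorem with page reference. The manuscript(s) under audit are NOT citable for their own
disputed steps — they are the thing under adjudication; programme-internal (2001/route/tribunal) claims are never citable.»

WHY (owner gen 13; `OWNER-MEMO-g12.md` §3 item 4, `K-CLOSURE-PLAN-R1L.md` §0).  Row D1 has TWO typed roots concluding the same literal term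
`OneStepKernelFamily.D1Drift Lc Js N μ ν`: the row OWNER an2's SPINE root `RowD1JointEndSymReflTablesAn1S2MW.d1Drift_…_D1Tel_D1Rep_of_locks` (p297092; binders
hR-letters, `D1Tel Lc Js Jc`, `D1Rep Lc Jc Nc μ ν a SL k` at `Js := JsB12Sym …`) and this road's «END-ii» END (binders bridge B1 `hB1 : |Σ_{j<m} β⁰_j − c(Lc^m)| ≤ U₁`,
the (K) slot `hK : c n = ω_gl·M₂[TOfRed …] + ω_gh·M₂[PghQ …] + Σ_u Ru u n`, sockets∕pins∕printed statements).  The two roots did not share ONE binder by name.  This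
file is the junction on the B1 side, and it TYPES the (K) slot against the spine's own object:
* §1 `sum_secondMoment_TbalOf_eq_TshotOf`: under the spine's `D1Tel Lc Js Jc` (Hessian telescoping) and the printed symmetries `WardTransversal`∕`AxisReflectionCovariant`
  of the flipped step kernels (the spine's `hW`∕`hR`, literally the binders of `OneStepKernelFamily.d1Drift_of_D1Tel_D1Rep`), the partial sums of the step coefficients ARE
  the (1.22) second moments of the literal one-shot kernels: `Σ_{j<m} M₂[TbalOf Lc Js j] = M₂[TshotOf Lc Jc m]`, EXACTLY, every `m ≥ 1`.  Hence (`hB1_iff_hKshot_of_D1Tel`)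
  the road's bridge B1 with constant `U₁` is EQUIVALENT to the ONE-SHOT (K)-ESTIMATE `hKshot : ∀ m ≥ 1, |M₂[TshotOf Lc Jc m] − c(Lc^m)| ≤ U₁` — B1 ↔ D1Tel made kernel.
* §2 `d1Drift_BFx_of_D1Tel_shotKS`: the «END-ii» END v1.1 with `hB1` REPLACED by `(Jc)(hW)(hRfl)(htel : D1Tel Lc Js Jc)(hKshot)`; every other binder BYTE-IDENTICAL.  After this
  file the road's END and the spine's root display `D1Tel` (and `hW`∕`hR` in the Literature's flipped-kernel form) BY THE SAME NAMES, and the road's (K) slot reads, composed: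
  `hKshot ∘ hK` = «the (1.22) second moment of the literal one-shot kernel `TshotOf Lc Jc m` of the composite system at `U = 1` is, within `U₁` uniformly in `m`, the
  background-Feynman one-shot expression at side `n = Lc^m`» — ONE estimate about ONE kernel, the (K)-closure target of `K-CLOSURE-PLAN-R1L.md` §0 (`shotCoeff n :=
  M₂[TshotOf Lc Jc m]`) now stated against the spine's object instead of a free `c`.  What it does NOT do: prove `hKshot` for any `Jc` (that is the (A1)–(A3) dictionary),
  construct Bałaban's composite jets `Jc`, or touch `D1Rep` (the D1Rep-side junction — the road's rows + `hKshot` ⟹ `D1Rep` modulo the comparison of the two explicit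
  one-shot sides `Σ_b n⁻⁴·fullSum (stK μ ν N (gfrz n a b))` vs `ScalewiseVectorSeam.oneShotSide` — is the next owner file).

CONTENT.
* §1 [folklore] `sum_secondMoment_TbalOf_eq_TshotOf`, `hB1_of_D1Tel_hKshot`, `hKshot_of_D1Tel_hB1`, `hB1_iff_hKshot_of_D1Tel`.
* §2 [folklore] **`d1Drift_BFx_of_D1Tel_shotKS`** — THE «END-ii» END v1.1 OVER THE SPINE's `D1Tel`: `D1Drift Lc Js N μ ν` for ANY `Js`, `μ ≠ ν`, `N ≠ 0`, odd `Lc ≥ 2`, from,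
  DISPLAYED VERBATIM: composite jet data `Jc`, `hW`∕`hRfl` (printed symmetries of `flipK (TbalOf Lc Js j)`), `htel : D1Tel Lc Js Jc`, `hKshot`; (K) `hK` + `hωs` + `hs` + `hlam`;
  the pins; the ray + P13; the five slot-table sockets with covariance and bond swap; `hdiv`; the shell rows `h2s`∕`d2s`; slot E∕R∕Q sockets; the (Λ) sockets + (W1)(W2′);
  (U); `h12`∕`h126` BY NAME.  NO rest-word row, NO Ward row (as in v1.1).
Unit `b2b-balaban-beta-d1-p2` (gen 13), road «BF-x» OWNER; `LEAVES-BFx.md` row «END-D1Tel-S»; CENSUS-K6a §v4.21.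
-/

noncomputable section

open Finset Filter Topology
open Literature.Probability.LatticeModels (annulus)
open scoped BigOperators
open Literature.MathematicalPhysics.QuantumFieldTheory.Balaban1983to89
open Literature.MathematicalPhysics.QuantumFieldTheory.Balaban1983to89.Beta
open OneStepResolventKernel (JetData KInv)
open OneStepKernelFamily (TbalOf TshotOf flipK D1Tel D1Drift hdec_TbalOf)
open PolarizationSign (WardTransversal AxisReflectionCovariant)
open ScalewiseVectorSeam (scalewiseData_of_printed_flip readout122 readout122_add readout122_m2Tensor)
open HidentScalewise (flowSum_eq_oneShotReadout)
open InterLevelTransport (onLat)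
open BalabanStepJets (lamCoeffOf)
open AveragingHessianKernels (hessFF)
open KernelWard (divV)
open WindowIdentification (fullSum psum)
open B12Sec2to5 (l1)
open DyadicShell (Pt toReal supNorm)
open ExpKernelCalculus (Site MKer BiLoc shiftK comp)
open GhostTable (gFree)
open BubbleTransfer (unitVec)
open DressedMomentNormalisation (resSite)
open PoissonInterior (nrm)
open Summit.QuantumFields.BalabanUV.Beta.TameKernelCalculus (Spr Loc trK)
open Summit.QuantumFields.BalabanUV.Beta.D1BFx.ReducedKernel (TableR TOfRed)
open Summit.QuantumFields.BalabanUV.Beta.D1BFx.DressedTadpoleTable (tableRed tadpoleTable)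
open Summit.QuantumFields.BalabanUV.Beta.D1BFx.ReducedKernelSandwich (fineHess)
open Summit.QuantumFields.BalabanUV.Beta.D1BFx.FineStencilBF (ffOf)
open Summit.QuantumFields.BalabanUV.Beta.D1BFx.FineStencilBFBalaban (SbfBal)
open Summit.QuantumFields.BalabanUV.Beta.D1BFx.SecondStencilBF (Wbf)
open Summit.QuantumFields.BalabanUV.Beta.D1BFx.GhostKernelComplete (PghQ fineHessGhQ)
open Summit.QuantumFields.BalabanUV.Beta.D1BFx.GluonLeg (Ga)
open Summit.QuantumFields.BalabanUV.Beta.D1BFx.FrozenLegProfile (gfrz)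
open Summit.QuantumFields.BalabanUV.Beta.D1BFx.RoadEndBFxWiredS (d1Drift_BFx_of_prop12S')
open Summit.QuantumFields.BalabanUV.Beta.D1BFx.FrozenLegTails (nOf MOf hn1)
open VectorTailsLoc (fam kfam)

namespace Summit.QuantumFields.BalabanUV.Beta.D1BFx.RoadEndBFxD1TelS

variable {Lc : ℕ} [NeZero Lc] {a N cgh₀ : ℝ} {μ ν : Fin 4} {υ : Type*} [Fintype υ]
  {cE cVH cΛ cR cK cQ cE₂ cJ4 cΛ₂ cR₂ cQ₂ x₀ ωgl ωgh cgh : ℕ → ℝ} {WE WJ WΛ WR WQ : ℕ → TableR} {CE CJ CΛt CRt CQ δW : ℕ → ℝ}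
  {Ru : υ → ℕ → ℝ} {CU : υ → ℝ} {D₂ U₁ : ℝ}
  {TΛ WA : ℕ → Fin 4 → Site 4 → Fin 4 → Site 4 → MKer 4 (Fin 4)} {CT δT : ℕ → ℝ}
  {ε : ℕ → ℝ} {X : ℕ → Site 4 → MKer 4 (Fin 4)} {Cx δx : ℕ → ℝ}

/-! ## §1 Bridge B1 IS the spine's `D1Tel`: the partial sums of the step coefficients are the one-shot second moments, exactly -/

/-- [folklore] **THE PARTIAL SUMS OF THE STEP COEFFICIENTS ARE THE (1.22) SECOND MOMENTS OF THE LITERAL ONE-SHOT KERNELS, EXACTLY.**  For step jet data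
`Js`, composite jet data `Jc`: the printed symmetries of the flipped step kernels (`WardTransversal`, `AxisReflectionCovariant` — the spine's `hW`∕`hR`, literally the
binders of `OneStepKernelFamily.d1Drift_of_D1Tel_D1Rep`) and the spine's telescoping predicate `D1Tel Lc Js Jc` give
`Σ_{j<m} secondMoment (TbalOf Lc Js j) μ ν = secondMoment (TshotOf Lc Jc m) μ ν` for every `m ≥ 1` and every channel `(μ, ν)`.  Proof: the scale-wise data
(`AbsMoment₂`, (T0), (T1)) from `hdec_TbalOf` + the two symmetries (`scalewiseData_of_printed_flip`), then `HidentScalewise.flowSum_eq_oneShotReadout` at the additive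
read-out `readout122 μ ν`, and `readout122_m2Tensor`.  A conditional identity; asserts nothing about Bałaban's jets. -/
theorem sum_secondMoment_TbalOf_eq_TshotOf (Js : ℕ → JetData 3 Lc) (Jc : ∀ m : ℕ, JetData 3 (Lc ^ m))
    (hW : ∀ j, WardTransversal (flipK (TbalOf Lc Js j))) (hRfl : ∀ j, AxisReflectionCovariant (flipK (TbalOf Lc Js j)))
    (htel : D1Tel Lc Js Jc) {m : ℕ} (hm : 1 ≤ m) :
    ∑ j ∈ range m, B12Beta.secondMoment (TbalOf Lc Js j) μ ν = B12Beta.secondMoment (TshotOf Lc Jc m) μ ν := by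
  obtain ⟨hTA, hT0, hT1⟩ := scalewiseData_of_printed_flip (hdec_TbalOf Js) hW hRfl
  have hβ : ∀ j, (fun j => B12Beta.secondMoment (TbalOf Lc Js j) μ ν) j =
      readout122 μ ν (DressedMomentNormalisation.m2Tensor (TbalOf Lc Js j)) :=
    fun j => (readout122_m2Tensor μ ν _).symm
  have h := flowSum_eq_oneShotReadout hTA hT0 hT1 htel (readout122_add μ ν) hβ hm
  rw [readout122_m2Tensor] at h
  exact h

/-- [folklore] **BRIDGE B1 FROM `D1Tel` + THE ONE-SHOT (K)-ESTIMATE.**  Under `hW`∕`hRfl`∕`D1Tel Lc Js Jc`, the one-shot estimate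
`hKshot : ∀ m ≥ 1, |secondMoment (TshotOf Lc Jc m) μ ν − c (Lc^m)| ≤ U₁` IS the road's bridge B1 `∀ m ≥ 1, |Σ_{j<m} secondMoment (TbalOf Lc Js j) μ ν − c (Lc^m)| ≤ U₁`
(same constant). -/
theorem hB1_of_D1Tel_hKshot (Js : ℕ → JetData 3 Lc) (Jc : ∀ m : ℕ, JetData 3 (Lc ^ m)) (c : ℕ → ℝ)
    (hW : ∀ j, WardTransversal (flipK (TbalOf Lc Js j))) (hRfl : ∀ j, AxisReflectionCovariant (flipK (TbalOf Lc Js j)))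
    (htel : D1Tel Lc Js Jc)
    (hKshot : ∀ m : ℕ, 1 ≤ m → |B12Beta.secondMoment (TshotOf Lc Jc m) μ ν - c (Lc ^ m)| ≤ U₁) :
    ∀ m : ℕ, 1 ≤ m → |(∑ j ∈ range m, B12Beta.secondMoment (TbalOf Lc Js j) μ ν) - c (Lc ^ m)| ≤ U₁ := by
  intro m hm
  rw [sum_secondMoment_TbalOf_eq_TshotOf Js Jc hW hRfl htel hm]
  exact hKshot m hm

/-- [folklore] **… AND CONVERSELY**: under `hW`∕`hRfl`∕`D1Tel Lc Js Jc`, the road's bridge B1 IS the one-shot (K)-estimate. -/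
theorem hKshot_of_D1Tel_hB1 (Js : ℕ → JetData 3 Lc) (Jc : ∀ m : ℕ, JetData 3 (Lc ^ m)) (c : ℕ → ℝ)
    (hW : ∀ j, WardTransversal (flipK (TbalOf Lc Js j))) (hRfl : ∀ j, AxisReflectionCovariant (flipK (TbalOf Lc Js j)))
    (htel : D1Tel Lc Js Jc)
    (hB1 : ∀ m : ℕ, 1 ≤ m → |(∑ j ∈ range m, B12Beta.secondMoment (TbalOf Lc Js j) μ ν) - c (Lc ^ m)| ≤ U₁) :
    ∀ m : ℕ, 1 ≤ m → |B12Beta.secondMoment (TshotOf Lc Jc m) μ ν - c (Lc ^ m)| ≤ U₁ := by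
  intro m hm
  rw [← sum_secondMoment_TbalOf_eq_TshotOf Js Jc hW hRfl htel hm]
  exact hB1 m hm

/-- [folklore] **B1 ↔ (K)-SHOT**: under `hW`∕`hRfl`∕`D1Tel Lc Js Jc` the road's bridge B1 and the one-shot (K)-estimate on `TshotOf Lc Jc` are EQUIVALENT, constant for
constant — the «B1 = D1Tel» line of `OWNER-MEMO-g12.md` §3 item 4 as a kernel statement. -/
theorem hB1_iff_hKshot_of_D1Tel (Js : ℕ → JetData 3 Lc) (Jc : ∀ m : ℕ, JetData 3 (Lc ^ m)) (c : ℕ → ℝ)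
    (hW : ∀ j, WardTransversal (flipK (TbalOf Lc Js j))) (hRfl : ∀ j, AxisReflectionCovariant (flipK (TbalOf Lc Js j)))
    (htel : D1Tel Lc Js Jc) :
    (∀ m : ℕ, 1 ≤ m → |(∑ j ∈ range m, B12Beta.secondMoment (TbalOf Lc Js j) μ ν) - c (Lc ^ m)| ≤ U₁) ↔
      (∀ m : ℕ, 1 ≤ m → |B12Beta.secondMoment (TshotOf Lc Jc m) μ ν - c (Lc ^ m)| ≤ U₁) :=
  ⟨hKshot_of_D1Tel_hB1 Js Jc c hW hRfl htel, hB1_of_D1Tel_hKshot Js Jc c hW hRfl htel⟩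

/-! ## §2 THE «END-ii» END v1.1 OVER THE SPINE's `D1Tel` AND THE ONE-SHOT (K)-ESTIMATE -/

/-- [folklore] **ROAD BF-x, THE «END-ii» END v1.1 OVER THE SPINE's TELESCOPING PREDICATE.**  `RoadEndBFxWiredS.d1Drift_BFx_of_prop12S'` (p297093) with its
bridge `hB1` REPLACED by: composite jet data `Jc`, the printed symmetries `hW`∕`hRfl` of the flipped step kernels `flipK (TbalOf Lc Js j)` (the spine's `hW`∕`hR`),
the spine's `htel : D1Tel Lc Js Jc`, and the ONE-SHOT (K)-ESTIMATE `hKshot : ∀ m ≥ 1, |secondMoment (TshotOf Lc Jc m) μ ν − c (Lc^m)| ≤ U₁` (§1).  Every other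
binder BYTE-IDENTICAL to v1.1: (K) `hK` pins `c` to the background-Feynman one-shot expression (so `hKshot ∘ hK` is the (K)-closure estimate about ONE kernel);
`hωs`+`hs`+`hlam`; pins `hcE`∕`hRsgn`∕`hJ4`; ray `hKray`∕`hQray`∕`hx` + P13 `hcgh`; the five slot-table sockets + covariance + bond swap; `hdiv`; shell rows `h2s`∕`d2s`;
slot E∕R∕Q sockets; (Λ) sockets + `cΛ ≠ 0`, `ε = ±1`, `hX`, (W1), (W2′); (U); `h12`∕`h126` BY NAME.  ⇒ `D1Drift Lc Js N μ ν` for ANY `Js`, `μ ≠ ν`, `N ≠ 0`, odd `Lc ≥ 2`.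
HONEST: composition BY NAME (§1 + v1.1); `D1Tel`, `hW`, `hRfl`, `hKshot`, `hK` and every socket∕pin are HYPOTHESES; 0 root-level binders discharged
(hW ∕ hR-sockets ∕ hSX-socket ∕ D1Tel ∕ D1Rep — 0); (K) NOT closed; NOT D1, NOT `BetaPertH`, NOT continuum, NOT Clay. -/
theorem d1Drift_BFx_of_D1Tel_shotKS (Js : ℕ → JetData 3 Lc) (hμν : μ ≠ ν) (hN : N ≠ 0) (hL : 2 ≤ Lc) (hodd : Odd Lc)
    (ha : 0 < a) (c : ℕ → ℝ) {A₂ δ₂ : ℝ} (hD₂ : 0 ≤ D₂) (hA₂ : 0 ≤ A₂) (hδ₂ : 0 < δ₂)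
    (h12 : B5.Prop12Printed (fam nOf hn1 MOf a ha)) (h126 : B5.Kernel126_127Printed (kfam nOf MOf))
    (h2s : ∀ n : ℕ, 2 ≤ n → ∀ [NeZero n], ∀ b ∈ (univ : Finset (Fin 4 → Fin n)).image resSite, ∀ r : ℕ, r + 1 ≤ n →
      ∑ v ∈ annulus 4 r (r + 1), |(gfrz n a b (v + unitVec ν + unitVec μ) - gFree (v + unitVec ν + unitVec μ)) -
          (gfrz n a b (v + unitVec ν) - gFree (v + unitVec ν)) - (gfrz n a b (v + unitVec μ) - gFree (v + unitVec μ)) +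
          (gfrz n a b v - gFree v)| ≤ D₂ / (n : ℝ))
    (d2s : ∀ n : ℕ, 2 ≤ n → ∀ [NeZero n], ∀ b ∈ (univ : Finset (Fin 4 → Fin n)).image resSite, ∀ r : ℕ, n ≤ r →
      ∑ v ∈ annulus 4 r (r + 1), |gfrz n a b (v + unitVec ν + unitVec μ) - gfrz n a b (v + unitVec ν) - gfrz n a b (v + unitVec μ) + gfrz n a b v| ≤
        A₂ * Real.exp (-(δ₂ / n) * ((r : ℝ) + 1)) / ((r : ℝ) + 1))
    -- bridge B1 REPLACED: composite jet data, the printed symmetries of the flipped step kernels, the spine's telescoping predicate, the one-shot (K)-estimate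
    (Jc : ∀ m : ℕ, JetData 3 (Lc ^ m))
    (hW : ∀ j, WardTransversal (flipK (TbalOf Lc Js j))) (hRfl : ∀ j, AxisReflectionCovariant (flipK (TbalOf Lc Js j)))
    (htel : D1Tel Lc Js Jc)
    (hKshot : ∀ m : ℕ, 1 ≤ m → |B12Beta.secondMoment (TshotOf Lc Jc m) μ ν - c (Lc ^ m)| ≤ U₁)
    (hK : ∀ n : ℕ, 2 ≤ n → Odd n → ∀ [NeZero n], c n =
      ωgl n * B12Beta.secondMoment (TOfRed n a (SbfBal n a (cE n) (cVH n) (cΛ n) (cR n) (cK n) (cQ n))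
        (tableRed n (Wbf (cE₂ n) (cJ4 n) (cΛ₂ n) (cR₂ n) (cQ₂ n) (WE n) (WJ n) (WΛ n) (WR n) (WQ n)))) μ ν
      + ωgh n * B12Beta.secondMoment (PghQ n a (x₀ n) (cK n) (cQ n)) μ ν + ∑ u, Ru u n)
    -- the RESCALED loop-weight tie of reading (ii): displayed scalar family `s`, pinned `s n = n⁻²`; the normalisation
    (s : ℕ → ℝ) (hs : ∀ n : ℕ, 2 ≤ n → s n = ((n : ℝ) ^ 2)⁻¹) (hωs : ∀ n : ℕ, 2 ≤ n → ωgh n * (s n * cK n) ^ 2 = -2 * (ωgl n * cE n ^ 2))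
    (hlam : ∀ n : ℕ, 2 ≤ n → ωgl n * cE n ^ 2 = 2 * N ^ 2 * (n : ℝ) ^ 8)
    -- pins and the ray (the rows' letters)
    (hcE : ∀ n : ℕ, 2 ≤ n → cE n = (n : ℝ) ^ 4) (hRsgn : ∀ n : ℕ, 2 ≤ n → cR n = -cE n) (hJ4 : ∀ n : ℕ, cJ4 n = 0)
    (hcgh : ∀ n : ℕ, |cgh n| ≤ cgh₀) (hKray : ∀ n : ℕ, cK n = cgh n * (n : ℝ) ^ 2) (hQray : ∀ n : ℕ, cQ n = cgh n * a) (hx : ∀ n : ℕ, x₀ n = -cgh n)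
    -- slot-table sockets (the END's), covariance, bond swap; `hdiv` (the ghost Ward rows `hrowgh` are a THEOREM on the ray: discharged inside)
    (hδW : ∀ n, 0 < δW n)
    (hE : ∀ n κ u l u', BiLoc (WE n κ u l u') u u' (CE n) (δW n)) (hJ : ∀ n κ u l u', BiLoc (WJ n κ u l u') u u' (CJ n) (δW n))
    (hΛ : ∀ n κ u l u', BiLoc (WΛ n κ u l u') u u' (CΛt n) (δW n)) (hR : ∀ n κ u l u', BiLoc (WR n κ u l u') u u' (CRt n) (δW n))
    (hQ : ∀ n κ u l u', BiLoc (WQ n κ u l u') u u' (CQ n) (δW n))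
    (hEc : ∀ (n : ℕ) (κ : Fin 4) (u : Site 4) (l : Fin 4) (u' t : Site 4),
      WE n κ (u + (n : ℤ) • t) l (u' + (n : ℤ) • t) = shiftK (-((n : ℤ) • t)) (WE n κ u l u'))
    (hJc : ∀ (n : ℕ) (κ : Fin 4) (u : Site 4) (l : Fin 4) (u' t : Site 4),
      WJ n κ (u + (n : ℤ) • t) l (u' + (n : ℤ) • t) = shiftK (-((n : ℤ) • t)) (WJ n κ u l u'))
    (hΛc : ∀ (n : ℕ) (κ : Fin 4) (u : Site 4) (l : Fin 4) (u' t : Site 4),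
      WΛ n κ (u + (n : ℤ) • t) l (u' + (n : ℤ) • t) = shiftK (-((n : ℤ) • t)) (WΛ n κ u l u'))
    (hRc : ∀ (n : ℕ) (κ : Fin 4) (u : Site 4) (l : Fin 4) (u' t : Site 4),
      WR n κ (u + (n : ℤ) • t) l (u' + (n : ℤ) • t) = shiftK (-((n : ℤ) • t)) (WR n κ u l u'))
    (hQc : ∀ (n : ℕ) (κ : Fin 4) (u : Site 4) (l : Fin 4) (u' t : Site 4),
      WQ n κ (u + (n : ℤ) • t) l (u' + (n : ℤ) • t) = shiftK (-((n : ℤ) • t)) (WQ n κ u l u'))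
    (hEs : ∀ n κ u l u', WE n κ u l u' = WE n l u' κ u) (hJs : ∀ n κ u l u', WJ n κ u l u' = WJ n l u' κ u)
    (hΛs : ∀ n κ u l u', WΛ n κ u l u' = WΛ n l u' κ u) (hRs : ∀ n κ u l u', WR n κ u l u' = WR n l u' κ u)
    (hQs : ∀ n κ u l u', WQ n κ u l u' = WQ n l u' κ u)
    (hdiv : ∀ n : ℕ, 2 ≤ n → ∀ [NeZero n], ∀ (l' : Fin 4) (u' u : Site 4), ∑ κ' : Fin 4,
      (fineHess n a (SbfBal n a (cE n) (cVH n) (cΛ n) (cR n) (cK n) (cQ n))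
          (Wbf (cE₂ n) (cJ4 n) (cΛ₂ n) (cR₂ n) (cQ₂ n) (WE n) (WJ n) (WΛ n) (WR n) (WQ n)) κ' l' (u - Pi.single κ' 1) u'
        - fineHess n a (SbfBal n a (cE n) (cVH n) (cΛ n) (cR n) (cK n) (cQ n))
          (Wbf (cE₂ n) (cJ4 n) (cΛ₂ n) (cR₂ n) (cQ₂ n) (WE n) (WJ n) (WΛ n) (WR n) (WQ n)) κ' l' u u') = 0)
    -- (LOCAL) slot-E support and units; slot-R envelope and units (the three local ghost bubbles are SUPPLIED under reading (ii))
    {ρE : ℕ} {δ₀ kE : ℝ} (hδ₀ : 0 < δ₀) (hδE : ∀ n, δ₀ ≤ δW n)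
    (hsuppE : ∀ n κ u l u', ρE < supNorm (u - u') → WE n κ u l u' = 0)
    (hkE : ∀ n : ℕ, 2 ≤ n → |ωgl n * cE₂ n| * CE n ≤ kE * (n : ℝ) ^ 8)
    {CwR δR : ℕ → ℝ} {θR δ₀R kR : ℝ} (hθR : 0 < θR) (hδR : ∀ n, 0 < δR n) (hδ₀R : 0 < δ₀R) (hδRge : ∀ n : ℕ, δ₀R / n ≤ δR n) (hCwR : ∀ n, 0 ≤ CwR n)
    (hWRenv : ∀ n κ u l u', BiLoc (WR n κ u l u') u u' (CwR n * Real.exp (-(θR / n) * supNorm (u - u'))) (δR n))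
    (hkR : ∀ n : ℕ, 2 ≤ n → |ωgl n * cR₂ n| * CwR n * (n : ℝ) ^ 6 ≤ kR)
    -- (Λ) sockets and zero-momentum data
    (hδT : ∀ n, 0 < δT n)
    (hdec : ∀ n : ℕ, 2 ≤ n → ∀ [NeZero n], ∀ κ u l u', WΛ n κ u l u' =
      (∑ m : Fin 4, OneStepResolventKernel.wsum (onLat n (fun y => lamCoeffOf (KInv (N := n) (d := 3)) n m y l u'))
          (fun v => onLat n (fun y => TΛ n m y κ u) v))
      + (∑ m : Fin 4, OneStepResolventKernel.wsum (onLat n (fun y => lamCoeffOf (KInv (N := n) (d := 3)) n m y κ u))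
          (fun v => onLat n (fun y => TΛ n m y l u') v))
      + WA n κ u l u')
    (hTloc : ∀ (n : ℕ) m y κ u, BiLoc (TΛ n m y κ u) ((n : ℤ) • y) ((n : ℤ) • y) (CT n * Real.exp (-δT n * l1 ((n : ℤ) • y - u))) (δT n))
    (hWAa : ∀ n κ u l u', trK (WA n κ u l u') = -WA n κ u l u') (hWAl : ∀ n κ u l u', Loc (WA n κ u l u'))
    (hTcov : ∀ (n : ℕ) m y κ u t, TΛ n m (y + t) κ (u + (n : ℤ) • t) = shiftK (-((n : ℤ) • t)) (TΛ n m y κ u))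
    (hcΛ : ∀ n : ℕ, 2 ≤ n → cΛ n ≠ 0) (hε : ∀ n : ℕ, ε n = 1 ∨ ε n = -1) (hδx : ∀ n, 0 < δx n) (hX : ∀ n u, BiLoc (X n u) u u (Cx n) (δx n))
    (hW1 : ∀ n : ℕ, 2 ≤ n → ∀ [NeZero n], ∀ u,
      comp (comp (Ga n a) (divV (fun κ v => ε n • SbfBal n a (cE n) (cVH n) (cΛ n) (cR n) (cK n) (cQ n) κ v) u)) (Ga n a) =
        comp (Ga n a) (X n u) - comp (X n u) (Ga n a))
    (hW2 : ∀ n : ℕ, 2 ≤ n → ∀ [NeZero n], ∀ (m : Fin 4) (u : Site 4),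
      divV (fun κ v => (-(ε n * (cΛ₂ n / cΛ n))) • TΛ n m 0 κ v) u = comp (X n u) (ffOf (hessFF n m 0)) - comp (ffOf (hessFF n m 0)) (X n u))
    -- (N) slot Q's SOCKETS (the (A2) readout of `WQ`: a decaying bi-localisation envelope at a BLOCK-scale rate floor and its units line — T₈ ⟸ `NeedleTadpoleRowDecay`)
    {CwQ δQ : ℕ → ℝ} {θQ δ₀Q kQ : ℝ} (hθQ : 0 < θQ) (hδQ : ∀ n, 0 < δQ n) (hδ₀Q : 0 < δ₀Q) (hδQge : ∀ n : ℕ, δ₀Q / n ≤ δQ n) (hCwQ : ∀ n, 0 ≤ CwQ n)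
    (hWQenv : ∀ n κ u l u', BiLoc (WQ n κ u l u') u u' (CwQ n * Real.exp (-(θQ / n) * supNorm (u - u'))) (δQ n))
    (hkQ : ∀ n : ℕ, 2 ≤ n → |ωgl n * cQ₂ n| * CwQ n * (n : ℝ) ^ 6 ≤ kQ)
    -- (U)
    (hU : ∀ n : ℕ, 2 ≤ n → ∀ u, |Ru u n| ≤ CU u) :
    D1Drift Lc Js N μ ν :=
  d1Drift_BFx_of_prop12S' Js hμν hN hL hodd ha c hD₂ hA₂ hδ₂ h12 h126 h2s d2s (hB1_of_D1Tel_hKshot Js Jc c hW hRfl htel hKshot) hK s hs hωs hlam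
    hcE hRsgn hJ4 hcgh hKray hQray hx hδW hE hJ hΛ hR hQ hEc hJc hΛc hRc hQc hEs hJs hΛs hRs hQs hdiv hδ₀ hδE hsuppE hkE hθR hδR hδ₀R hδRge hCwR hWRenv
    hkR hδT hdec hTloc hWAa hWAl hTcov hcΛ hε hδx hX hW1 hW2 hθQ hδQ hδ₀Q hδQge hCwQ hWQenv hkQ hU

end Summit.QuantumFields.BalabanUV.Beta.D1BFx.RoadEndBFxD1TelS

end
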